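import Summits.QuantumFields.BalabanUV.Beta.GAN24.AliasObjects
import Summits.QuantumFields.BalabanUV.Beta.GAN24.AliasWeightsSum
import Summits.QuantumFields.BalabanUV.Beta.GAN24.SymbolTaylor

/-!
# `BalabanUV.Beta.GAN24.ReadingWeightSums` — binder row G-an2-4 / (CONV-C), road P1-fibre, typer row **P1-Y09b** (node N12b of
# `HOME/GAN24/Formal/DAG.md`; S1c / A2 of `SKELETON-P1.md`): the M-LEVEL READING / SOURCE WEIGHTS of the leg sums and their
# N-uniform alias sums

NOT IN PRINT; OUR PROOF ATTEMPT.  HONEST FRAMING (cell contract, verbatim): «discharging `BetaPertH` makes Bałaban's UV stability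
UNCONDITIONAL — a real constructive-QFT result; it is NOT the continuum limit and NOT the Clay problem.»  HONEST DEPENDENCY (verbatim):
«continuum YM on T⁴ ⇐ BetaPertH ∧ nine spine estimates (0/9 proved); BetaPertH ⇐ (D1) ∧ (D4) ∧ CAP+tail; G-an2-4 gates asym, D1 and
NE2/3/4.»  [folklore] explicit trigonometric bookkeeping (geometric sums, Jordan, the alias-sum bound of leaf P1-L06 BY NAME); it
discharges NOTHING of (CONV-C) by itself; no `def … : Prop`, no cited fact, no wall binder.  NOT summit progress.
Unit `b2b-balaban-gan24-formalise-leaf-01` (G-an2-4 formalisation swarm, leaf prover 01), 2026-08-19.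

## The objects — BY NAME from typer row P1-T00 (`GAN24/AliasObjects`, leaf-14-g7, landed while this row was being written)
For a box of side `N` (one Bloch fibre), a DECIMATION box of side `M` (in the application `N = M·Lc`), a COMPLEX coarse momentum
`p : Fin D → ℂ` (strip-ready; the estimates are at real momenta `B4Strip.ofRealVec p`), an alias `m ∈ TorusSite D N` with fine momentum
`k = AliasObjects.kAl N p m = FibreDFT.kFine p m = (p + 2π·repZ m)/N`, a leg direction `κ` and a coarse offset `ρ : Fin D → ℤ`:
* `AliasObjects.readW N M p m κ ρ = e^{i k·(Mρ)} · S_M(m) · s_{M,κ}(m) / M^{D+1}` (`SMAl`, `sMAl` = products / values of `gs z M = Σ_{t<M} e^{izt}`)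
  — the READING weight of a field leg (S1c of `SKELETON-P1.md`; spec `kmat_closed: Wread`);
* `AliasObjects.srcW N M p m l ρ′` = the flat twin (`k ↦ −k`) over `M^{D+1}·N^D` — the SOURCE weight.
Nothing is re-defined here (0 `def`): this file is the ESTIMATE layer over those objects, in the `sinWt`/`wMaj`/`aliasWtTerm` currency of
leaf P1-L06 (`GAN24/AliasWeights(+Sum)`), with the dictionary `kAl N (ofRealVec p) m = ofRealVec (AliasWeights.kfine N p m)`.

## What is proved (all at REAL momenta `p ∈ [−π, π]^D` unless marked; constants explicit; `Lc`-dependence displayed as `N/M`)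
* §1 dictionary with leaves P1-L04a/L06/T00: `kFine_ofRealVec`/`kAl_ofRealVec` (`kAl N (ofRealVec p) m i = kfine N p m i`), the block
  sums at real momenta in the explicit `Finset.range` form of leaf P1-L06 (`sMAl_ofRealVec`, `SMAl_ofRealVec`, `sbMAl_ofRealVec`,
  `SbMAl_ofRealVec`), unimodularity of the offset phases, `sinWt_neg` (the flat twin has the same weights), `natPow_mul_srcW`, and the
  geometric weight bound `norm_blockWeight_sq_le` (`‖S_M·s_{M,κ}/M^{D+1}‖² ≤ (Π_i sinWt M x_i)·sinWt M x_κ`).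
* §2 (i) WEIGHT BOUNDS in the `sinWt` currency of P1-L06: `norm_readW_sq_le` — `‖readW‖² ≤ (Π_i sinWt M k_i)·sinWt M k_κ`
  (i.e. `‖readW‖ ≤ Π_i min(1, 1/(M|sin(k_i/2)|))·min(1, 1/(M|sin(k_κ/2)|))`), `norm_srcW_sq_le` — the same for `N^D·‖srcW‖`; crude forms
  `norm_readW_le_one`, `norm_srcW_le_one`.
  (ii) CHANGE OF BOX (the `Lc = N/M` dependence): `norm_readW_sq_le_N` — `‖readW‖² ≤ (N/M)^{2(D+1)}·(Π_i sinWt N k_i)·sinWt N k_κ`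
  (`AliasWeights.sinWt_le_sq_mul_sinWt`), and the discrete Jordan majorant `≤ (N/M)^{2(D+1)}·(Π_i wMaj N (m i))·wMaj N (m κ)`
  (`AliasWeights.sinWt_kfine_le_wMaj`: `wMaj = val⁻² + (N − val)⁻²` off the zero class — the `min(1, π·Lc/|q_i|)²`-type weight in alias
  coordinates `q = p + 2π·rep m`).
* §3 (iii) THE N-UNIFORM WEIGHTED ALIAS SUM with the T-block majorant `1/(N²·lapR k_m)`: `norm_readW_mul_norm_srcW_le` (termwise
  `‖readW m κ ρ‖·‖N^D srcW m l ρ′‖ ≤ Π_i sinWt M k_i ≤ (N/M)^{2D}·Π_i sinWt N k_i`), **`offZero_sum_le`** —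
  `Σ_{m ≠ 0} ‖readW m κ ρ‖·‖N^D·srcW m l ρ′‖/(N²·lapR k_m) ≤ (N/M)^{2D} · aliasWtConst D` (`AliasWeightsSum.alias_sum_le` BY NAME;
  `aliasWtConst D = (5^D − 1)/4`), uniformly in `N`, `M ≤ N`, `p`, `κ`, `l`, `ρ`, `ρ′`; and the m = 0 TERM displayed separately:
  `zero_term_le` — `≤ 1/(N²·lapR(p/N))` with the Jordan form `zero_term_le_momSq` — `≤ (π²/4)/|p|²` for `p ≠ 0`
  (`SymbolTaylor.two_sided_sq_mul_lapSym`): this is the transverse POLE of the m = 0 block, cancelled downstream (rows L08a / Y09a), NOT here.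
* §4 (iv) the three UNIT EXPONENTS of S1c against `CombesThomas.sfStep`/`smStep` (`M = Lc^j`): `sfStep² = M²`, `sfStep·smStep = M^{d+2}`,
  `smStep² = M^{2(d+1)}` for every `d`, and at the adopted dimension `d = 3` (`D = 4`) these ARE S1c's `M^{D−2}`, `M^{D+1}`, `M^{D+4}`
  (`units_S1c_at_three`; no mismatch — risk R1 of `SKELETON-P1` §6 does not fire at the level of exponents); the field block's `N`-freeness
  `sfStep² / N² = 1/Lc²` (`N = Lc^(j+1)`; A4′(v) «N^{2−D}·s_f² = Lc^{2−D}» at `D = 4`).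
NOT here: the identification `kFib = Σ readW·(F⁻¹)·srcW` (row P1-L05b), any capacitance quantity, any rate.  NOT BetaPertH, NOT continuum,
NOT Clay.
-/

noncomputable section

open Complex Finset
open scoped BigOperators Real

namespace Summit.QuantumFields.BalabanUV.Beta.GAN24.ReadingWeightSums

open Literature.Probability.LatticeModels (TorusSite)
open Literature.MathematicalPhysics.QuantumFieldTheory.LatticeForm (repZ)
open Literature.MathematicalPhysics.QuantumFieldTheory.Balaban1983to89.B4Strip (ofRealVec)
open Literature.MathematicalPhysics.QuantumFieldTheory.King1986 (momSq momSq_nonneg)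
open AliasWeights (sinWt sinWt_pos sinWt_le_one kfine wMaj wMaj_nonneg norm_geomExp_le norm_prod_geomExp_mul_sq_le
  norm_prod_geomExp_sq_le sinWt_le_sq_mul_sinWt sinWt_kfine_le_wMaj)
open AliasWeightsSum (lapR lapR_nonneg aliasWtTerm aliasWtConst alias_sum_le four_le_sq_mul_lapR)
open FibreDFT (kFine)
open CombesThomas (sfStep smStep)
open AliasObjects (kAl gs sMAl SMAl sbMAl SbMAl readW srcW)

variable {D N : ℕ}

/-! ## §1 The real-momentum dictionary for the objects of `GAN24/AliasObjects` -/

/-- [folklore] DICTIONARY with leaf P1-L06: at a real momentum the fine momentum of `FibreDFT` is the real fine momentum `kfine` of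
`AliasWeights`, coordinatewise. -/
theorem kFine_ofRealVec (p : Fin D → ℝ) (m : TorusSite D N) (i : Fin D) :
    kFine (ofRealVec p) m i = ((kfine N p m i : ℝ) : ℂ) := by
  unfold kFine kfine ofRealVec repZ
  push_cast
  ring

variable [NeZero N]

/-- [folklore] The same for T00's `kAl` (`= kFine` by `rfl`). -/
theorem kAl_ofRealVec (p : Fin D → ℝ) (m : TorusSite D N) (i : Fin D) : kAl N (ofRealVec p) m i = ((kfine N p m i : ℝ) : ℂ) :=
  kFine_ofRealVec p m i

/-- [folklore] The flat fine momentum at a real momentum. -/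
theorem neg_kAl_ofRealVec (p : Fin D → ℝ) (m : TorusSite D N) (i : Fin D) :
    -kAl N (ofRealVec p) m i = (((-kfine N p m i : ℝ)) : ℂ) := by
  rw [kAl_ofRealVec]; push_cast; ring

/-- [folklore] `s_{M,κ}(m)` at a real momentum, in the explicit-sum form of leaf P1-L06. -/
theorem sMAl_ofRealVec (M : ℕ) (p : Fin D → ℝ) (m : TorusSite D N) (κ : Fin D) :
    sMAl N M (ofRealVec p) m κ = ∑ t ∈ Finset.range M, cexp (I * (kfine N p m κ : ℂ) * t) := by
  unfold sMAl gs
  rw [kAl_ofRealVec]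

/-- [folklore] `S_M(m)` at a real momentum. -/
theorem SMAl_ofRealVec (M : ℕ) (p : Fin D → ℝ) (m : TorusSite D N) :
    SMAl N M (ofRealVec p) m = ∏ i, ∑ t ∈ Finset.range M, cexp (I * (kfine N p m i : ℂ) * t) := by
  unfold SMAl
  exact Finset.prod_congr rfl fun i _ => sMAl_ofRealVec M p m i

/-- [folklore] The flat `s♭_{M,κ}(m)` at a real momentum: the block sum at the negated real fine momentum. -/
theorem sbMAl_ofRealVec (M : ℕ) (p : Fin D → ℝ) (m : TorusSite D N) (κ : Fin D) :
    sbMAl N M (ofRealVec p) m κ = ∑ t ∈ Finset.range M, cexp (I * ((-kfine N p m κ : ℝ) : ℂ) * t) := by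
  unfold sbMAl gs
  rw [neg_kAl_ofRealVec]

/-- [folklore] The flat `S♭_M(m)` at a real momentum. -/
theorem SbMAl_ofRealVec (M : ℕ) (p : Fin D → ℝ) (m : TorusSite D N) :
    SbMAl N M (ofRealVec p) m = ∏ i, ∑ t ∈ Finset.range M, cexp (I * ((-kfine N p m i : ℝ) : ℂ) * t) := by
  unfold SbMAl
  exact Finset.prod_congr rfl fun i _ => sbMAl_ofRealVec M p m i

/-- [folklore] At real momentum the offset phase is unimodular. -/
theorem norm_cexp_offset (p : Fin D → ℝ) (m : TorusSite D N) (M : ℕ) (ρ : Fin D → ℤ) :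
    ‖cexp (I * ∑ i, kAl N (ofRealVec p) m i * ((M : ℂ) * (ρ i : ℂ)))‖ = 1 := by
  have h : (∑ i, kAl N (ofRealVec p) m i * ((M : ℂ) * (ρ i : ℂ))) = ((∑ i, kfine N p m i * ((M : ℝ) * (ρ i : ℝ)) : ℝ) : ℂ) := by
    push_cast
    exact Finset.sum_congr rfl fun i _ => by rw [kAl_ofRealVec]
  rw [h, Complex.norm_exp_I_mul_ofReal]

/-- [folklore] At real momentum the flat offset phase is unimodular. -/
theorem norm_cexp_neg_offset (p : Fin D → ℝ) (m : TorusSite D N) (M : ℕ) (ρ : Fin D → ℤ) :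
    ‖cexp (-(I * ∑ i, kAl N (ofRealVec p) m i * ((M : ℂ) * (ρ i : ℂ))))‖ = 1 := by
  have h : -(I * ∑ i, kAl N (ofRealVec p) m i * ((M : ℂ) * (ρ i : ℂ))) =
      I * ((-(∑ i, kfine N p m i * ((M : ℝ) * (ρ i : ℝ))) : ℝ) : ℂ) := by
    push_cast
    rw [Finset.sum_congr rfl fun i _ => by rw [kAl_ofRealVec]]
    ring
  rw [h, Complex.norm_exp_I_mul_ofReal]

omit [NeZero N] in
/-- [folklore] The one-coordinate weight is even: `sinWt M (−x) = sinWt M x`. -/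
theorem sinWt_neg (M : ℕ) (x : ℝ) : sinWt M (-x) = sinWt M x := by
  simp only [sinWt, neg_div, Real.sin_neg, mul_neg, neg_sq]

omit [NeZero N] in
/-- [folklore] THE GEOMETRIC WEIGHT BOUND at a real fine momentum `x` (`M ≥ 1`): `‖(Π_i G(x_i,M))·G(x_κ,M)/M^{D+1}‖² ≤ (Π_i sinWt M x_i)·sinWt M x_κ`
(leaf P1-L06 `norm_prod_geomExp_mul_sq_le` BY NAME, divided by `M^{2(D+1)}`). -/
theorem norm_blockWeight_sq_le {M : ℕ} (hM : 0 < M) (x : Fin D → ℝ) (κ : Fin D) :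
    ‖(∏ i, ∑ t ∈ Finset.range M, cexp (I * (x i : ℂ) * t)) * (∑ t ∈ Finset.range M, cexp (I * (x κ : ℂ) * t)) / (M : ℂ) ^ (D + 1)‖ ^ 2
      ≤ (∏ i, sinWt M (x i)) * sinWt M (x κ) := by
  have hM' : (0 : ℝ) < M := by exact_mod_cast hM
  rw [norm_div, norm_pow, Complex.norm_natCast, div_pow, div_le_iff₀ (by positivity)]
  calc ‖(∏ i, ∑ t ∈ Finset.range M, cexp (I * (x i : ℂ) * t)) * ∑ t ∈ Finset.range M, cexp (I * (x κ : ℂ) * t)‖ ^ 2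
      ≤ ((M : ℝ) ^ 2) ^ D * (M : ℝ) ^ 2 * ((∏ i, sinWt M (x i)) * sinWt M (x κ)) := norm_prod_geomExp_mul_sq_le x κ M
    _ = (∏ i, sinWt M (x i)) * sinWt M (x κ) * ((M : ℝ) ^ (D + 1)) ^ 2 := by ring

/-- [folklore] `readW` at a real momentum, in explicit-sum form: phase × `(S_M·s_{M,κ})/M^{D+1}`. -/
theorem readW_ofRealVec (M : ℕ) (p : Fin D → ℝ) (m : TorusSite D N) (κ : Fin D) (ρ : Fin D → ℤ) :
    readW N M (ofRealVec p) m κ ρ = cexp (I * ∑ i, kAl N (ofRealVec p) m i * ((M : ℂ) * (ρ i : ℂ))) *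
      ((∏ i, ∑ t ∈ Finset.range M, cexp (I * (kfine N p m i : ℂ) * t)) * (∑ t ∈ Finset.range M, cexp (I * (kfine N p m κ : ℂ) * t)) /
        (M : ℂ) ^ (D + 1)) := by
  unfold readW
  rw [SMAl_ofRealVec, sMAl_ofRealVec]
  ring

/-- [folklore] `N^D · srcW` at a real momentum, in explicit-sum form: flat phase × `(S♭_M·s♭_{M,l})/M^{D+1}` (`N ≠ 0`). -/
theorem natPow_mul_srcW (M : ℕ) (p : Fin D → ℝ) (m : TorusSite D N) (l : Fin D) (ρ' : Fin D → ℤ) :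
    (N : ℂ) ^ D * srcW N M (ofRealVec p) m l ρ' = cexp (-(I * ∑ i, kAl N (ofRealVec p) m i * ((M : ℂ) * (ρ' i : ℂ)))) *
      ((∏ i, ∑ t ∈ Finset.range M, cexp (I * ((-kfine N p m i : ℝ) : ℂ) * t)) *
          (∑ t ∈ Finset.range M, cexp (I * ((-kfine N p m l : ℝ) : ℂ) * t)) / (M : ℂ) ^ (D + 1)) := by
  have hN : (N : ℂ) ^ D ≠ 0 := pow_ne_zero _ (Nat.cast_ne_zero.2 (NeZero.ne N))
  unfold srcW
  rw [SbMAl_ofRealVec, sbMAl_ofRealVec, ← mul_div_assoc, mul_div_cancel_left₀ _ hN]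
  ring

/-! ## §2 (i)–(ii) Weight bounds at real momenta -/

/-- [folklore] **(i) READING WEIGHT BOUND** in the `sinWt` currency of leaf P1-L06 (`M ≥ 1`): `‖readW‖² ≤ (Π_i sinWt M k_i)·sinWt M k_κ`
at real `p`, i.e. `‖readW‖ ≤ Π_i min(1, 1/(M|sin(k_i/2)|)) · min(1, 1/(M|sin(k_κ/2)|))`. -/
theorem norm_readW_sq_le {M : ℕ} (hM : 0 < M) (p : Fin D → ℝ) (m : TorusSite D N) (κ : Fin D) (ρ : Fin D → ℤ) :
    ‖readW N M (ofRealVec p) m κ ρ‖ ^ 2 ≤ (∏ i, sinWt M (kfine N p m i)) * sinWt M (kfine N p m κ) := by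
  rw [readW_ofRealVec, norm_mul, norm_cexp_offset, one_mul]
  exact norm_blockWeight_sq_le hM (kfine N p m) κ

/-- [folklore] **(i) SOURCE WEIGHT BOUND** (`M ≥ 1`, `N ≥ 1`): `‖N^D · srcW‖² ≤ (Π_i sinWt M k_i)·sinWt M k_l` at real `p`
(the flat twin has the same weights, `sinWt_neg`). -/
theorem norm_srcW_sq_le {M : ℕ} (hM : 0 < M) (p : Fin D → ℝ) (m : TorusSite D N) (l : Fin D) (ρ' : Fin D → ℤ) :
    ‖(N : ℂ) ^ D * srcW N M (ofRealVec p) m l ρ'‖ ^ 2 ≤ (∏ i, sinWt M (kfine N p m i)) * sinWt M (kfine N p m l) := by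
  rw [natPow_mul_srcW, norm_mul, norm_cexp_neg_offset, one_mul]
  have h := norm_blockWeight_sq_le hM (fun i => -kfine N p m i) l
  simp only [sinWt_neg] at h
  exact h

/-- [folklore] Crude form: `‖readW‖ ≤ 1` at real momenta (every weight is `≤ 1`). -/
theorem norm_readW_le_one {M : ℕ} (hM : 0 < M) (p : Fin D → ℝ) (m : TorusSite D N) (κ : Fin D) (ρ : Fin D → ℤ) :
    ‖readW N M (ofRealVec p) m κ ρ‖ ≤ 1 := by
  have h := norm_readW_sq_le hM p m κ ρ
  have h1 : (∏ i, sinWt M (kfine N p m i)) * sinWt M (kfine N p m κ) ≤ 1 :=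
    mul_le_one₀ (Finset.prod_le_one (fun i _ => (sinWt_pos _ _).le) fun i _ => sinWt_le_one _ _) (sinWt_pos _ _).le
      (sinWt_le_one _ _)
  nlinarith [norm_nonneg (readW N M (ofRealVec p) m κ ρ)]

/-- [folklore] Crude form: `‖N^D · srcW‖ ≤ 1` at real momenta. -/
theorem norm_srcW_le_one {M : ℕ} (hM : 0 < M) (p : Fin D → ℝ) (m : TorusSite D N) (l : Fin D) (ρ' : Fin D → ℤ) :
    ‖(N : ℂ) ^ D * srcW N M (ofRealVec p) m l ρ'‖ ≤ 1 := by
  have h := norm_srcW_sq_le hM p m l ρ'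
  have h1 : (∏ i, sinWt M (kfine N p m i)) * sinWt M (kfine N p m l) ≤ 1 :=
    mul_le_one₀ (Finset.prod_le_one (fun i _ => (sinWt_pos _ _).le) fun i _ => sinWt_le_one _ _) (sinWt_pos _ _).le
      (sinWt_le_one _ _)
  nlinarith [norm_nonneg ((N : ℂ) ^ D * srcW N M (ofRealVec p) m l ρ')]

/-- [folklore] **(ii) CHANGE OF BOX — the `Lc = N/M` dependence displayed**: for `0 < M ≤ N`,
`‖readW‖² ≤ (N/M)^{2(D+1)} · (Π_i sinWt N k_i) · sinWt N k_κ` (leaf P1-L06 `sinWt_le_sq_mul_sinWt`, one factor `(N/M)²` per weight). -/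
theorem norm_readW_sq_le_N {M : ℕ} (hM : 0 < M) (hMN : M ≤ N) (p : Fin D → ℝ) (m : TorusSite D N) (κ : Fin D) (ρ : Fin D → ℤ) :
    ‖readW N M (ofRealVec p) m κ ρ‖ ^ 2 ≤
      (((N : ℝ) / M) ^ 2) ^ (D + 1) * ((∏ i, sinWt N (kfine N p m i)) * sinWt N (kfine N p m κ)) := by
  refine (norm_readW_sq_le hM p m κ ρ).trans ?_
  have hP : ∏ i, sinWt M (kfine N p m i) ≤ ∏ i, ((N : ℝ) / M) ^ 2 * sinWt N (kfine N p m i) :=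
    Finset.prod_le_prod (fun i _ => (sinWt_pos _ _).le) fun i _ => sinWt_le_sq_mul_sinWt hM hMN _
  rw [Finset.prod_mul_distrib, Finset.prod_const, Finset.card_univ, Fintype.card_fin] at hP
  have hκ := sinWt_le_sq_mul_sinWt hM hMN (kfine N p m κ)
  have h0 : 0 ≤ (((N : ℝ) / M) ^ 2) ^ D * ∏ i, sinWt N (kfine N p m i) :=
    mul_nonneg (by positivity) (Finset.prod_nonneg fun i _ => (sinWt_pos _ _).le)
  calc (∏ i, sinWt M (kfine N p m i)) * sinWt M (kfine N p m κ)
      ≤ ((((N : ℝ) / M) ^ 2) ^ D * ∏ i, sinWt N (kfine N p m i)) * (((N : ℝ) / M) ^ 2 * sinWt N (kfine N p m κ)) :=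
        mul_le_mul hP hκ (sinWt_pos _ _).le h0
    _ = _ := by ring

/-- [folklore] **(ii) in alias coordinates** (discrete Jordan majorant of leaf P1-L06): for `|p_i| ≤ π`, `0 < M ≤ N`,
`‖readW‖² ≤ (N/M)^{2(D+1)} · (Π_i wMaj N (m i)) · wMaj N (m κ)`, `wMaj N r = val(r)⁻² + (N − val r)⁻²` off the zero class (`= 1` on it) —
the `min(1, (π·Lc/|q_i|)²)`-type decay in the alias coordinate `q = p + 2π·rep m`. -/
theorem norm_readW_sq_le_wMaj {M : ℕ} (hM : 0 < M) (hMN : M ≤ N) {p : Fin D → ℝ} (hp : ∀ i, |p i| ≤ π)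
    (m : TorusSite D N) (κ : Fin D) (ρ : Fin D → ℤ) :
    ‖readW N M (ofRealVec p) m κ ρ‖ ^ 2 ≤ (((N : ℝ) / M) ^ 2) ^ (D + 1) * ((∏ i, wMaj N (m i)) * wMaj N (m κ)) := by
  refine (norm_readW_sq_le_N hM hMN p m κ ρ).trans (mul_le_mul_of_nonneg_left ?_ (by positivity))
  exact mul_le_mul (Finset.prod_le_prod (fun i _ => (sinWt_pos _ _).le) fun i _ => sinWt_kfine_le_wMaj hp m i)
    (sinWt_kfine_le_wMaj hp m κ) (sinWt_pos _ _).le (Finset.prod_nonneg fun i _ => wMaj_nonneg _ _)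

/-! ## §3 (iii) The N-uniform weighted alias sum with the T-block majorant `1/(N²·lapR k_m)` -/

/-- [folklore] TERMWISE: `‖readW m κ ρ‖ · ‖N^D·srcW m l ρ′‖ ≤ Π_i sinWt M k_i` at real `p` (the two leg-direction weights are dropped,
`≤ 1`; `M, N ≥ 1`). -/
theorem norm_readW_mul_norm_srcW_le {M : ℕ} (hM : 0 < M) (p : Fin D → ℝ) (m : TorusSite D N) (κ l : Fin D)
    (ρ ρ' : Fin D → ℤ) :
    ‖readW N M (ofRealVec p) m κ ρ‖ * ‖(N : ℂ) ^ D * srcW N M (ofRealVec p) m l ρ'‖ ≤ ∏ i, sinWt M (kfine N p m i) := by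
  set P := ∏ i, sinWt M (kfine N p m i) with hP
  have hP0 : 0 ≤ P := Finset.prod_nonneg fun i _ => (sinWt_pos _ _).le
  have ha' : ‖readW N M (ofRealVec p) m κ ρ‖ ^ 2 ≤ P :=
    (norm_readW_sq_le hM p m κ ρ).trans (mul_le_of_le_one_right hP0 (sinWt_le_one _ _))
  have hb' : ‖(N : ℂ) ^ D * srcW N M (ofRealVec p) m l ρ'‖ ^ 2 ≤ P :=
    (norm_srcW_sq_le hM p m l ρ').trans (mul_le_of_le_one_right hP0 (sinWt_le_one _ _))
  have h1 : ‖readW N M (ofRealVec p) m κ ρ‖ ≤ Real.sqrt P := Real.le_sqrt_of_sq_le ha'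
  have h2 : ‖(N : ℂ) ^ D * srcW N M (ofRealVec p) m l ρ'‖ ≤ Real.sqrt P := Real.le_sqrt_of_sq_le hb'
  calc ‖readW N M (ofRealVec p) m κ ρ‖ * ‖(N : ℂ) ^ D * srcW N M (ofRealVec p) m l ρ'‖
      ≤ Real.sqrt P * Real.sqrt P := mul_le_mul h1 h2 (norm_nonneg _) (Real.sqrt_nonneg _)
    _ = P := Real.mul_self_sqrt hP0

/-- [folklore] TERMWISE with the change of box: `… ≤ (N/M)^{2D} · Π_i sinWt N k_i` (`0 < M ≤ N`). -/
theorem norm_readW_mul_norm_srcW_le_N {M : ℕ} (hM : 0 < M) (hMN : M ≤ N) (p : Fin D → ℝ) (m : TorusSite D N)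
    (κ l : Fin D) (ρ ρ' : Fin D → ℤ) :
    ‖readW N M (ofRealVec p) m κ ρ‖ * ‖(N : ℂ) ^ D * srcW N M (ofRealVec p) m l ρ'‖ ≤
      (((N : ℝ) / M) ^ 2) ^ D * ∏ i, sinWt N (kfine N p m i) := by
  refine (norm_readW_mul_norm_srcW_le hM p m κ l ρ ρ').trans ?_
  have hP : ∏ i, sinWt M (kfine N p m i) ≤ ∏ i, ((N : ℝ) / M) ^ 2 * sinWt N (kfine N p m i) :=
    Finset.prod_le_prod (fun i _ => (sinWt_pos _ _).le) fun i _ => sinWt_le_sq_mul_sinWt hM hMN _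
  rwa [Finset.prod_mul_distrib, Finset.prod_const, Finset.card_univ, Fintype.card_fin] at hP

/-- [folklore] **(iii) THE N-UNIFORM OFF-ZERO ALIAS SUM.**  For `0 < M ≤ N`, `p ∈ [−π, π]^D`, all `κ l ρ ρ′`:
`Σ_{m ≠ 0} ‖readW m κ ρ‖·‖N^D·srcW m l ρ′‖ / (N²·lapR k_m) ≤ (N/M)^{2D} · aliasWtConst D` — leaf P1-L06's `alias_sum_le` BY NAME
(`aliasWtConst D = (5^D − 1)/4`; in the application `N/M = Lc`).  Nothing else of S1c is estimated here. -/
theorem offZero_sum_le {M : ℕ} (hM : 0 < M) (hMN : M ≤ N) {p : Fin D → ℝ} (hp : ∀ i, |p i| ≤ π) (κ l : Fin D)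
    (ρ ρ' : Fin D → ℤ) :
    ∑ m ∈ (Finset.univ : Finset (TorusSite D N)).erase 0,
        ‖readW N M (ofRealVec p) m κ ρ‖ * ‖(N : ℂ) ^ D * srcW N M (ofRealVec p) m l ρ'‖ / ((N : ℝ) ^ 2 * lapR (kfine N p m))
      ≤ (((N : ℝ) / M) ^ 2) ^ D * aliasWtConst D := by
  classical
  have hterm : ∀ m ∈ (Finset.univ : Finset (TorusSite D N)).erase 0,
      ‖readW N M (ofRealVec p) m κ ρ‖ * ‖(N : ℂ) ^ D * srcW N M (ofRealVec p) m l ρ'‖ / ((N : ℝ) ^ 2 * lapR (kfine N p m))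
        ≤ (((N : ℝ) / M) ^ 2) ^ D * aliasWtTerm N p m := by
    intro m hm
    have hm0 : m ≠ 0 := (Finset.mem_erase.1 hm).1
    have hden : 0 < (N : ℝ) ^ 2 * lapR (kfine N p m) := lt_of_lt_of_le (by norm_num) (four_le_sq_mul_lapR hp hm0)
    unfold aliasWtTerm
    rw [← mul_div_assoc]
    exact div_le_div_of_nonneg_right (norm_readW_mul_norm_srcW_le_N hM hMN p m κ l ρ ρ') hden.le
  calc ∑ m ∈ (Finset.univ : Finset (TorusSite D N)).erase 0,
        ‖readW N M (ofRealVec p) m κ ρ‖ * ‖(N : ℂ) ^ D * srcW N M (ofRealVec p) m l ρ'‖ / ((N : ℝ) ^ 2 * lapR (kfine N p m))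
      ≤ ∑ m ∈ (Finset.univ : Finset (TorusSite D N)).erase 0, (((N : ℝ) / M) ^ 2) ^ D * aliasWtTerm N p m :=
        Finset.sum_le_sum hterm
    _ = (((N : ℝ) / M) ^ 2) ^ D * ∑ m ∈ (Finset.univ : Finset (TorusSite D N)).erase 0, aliasWtTerm N p m := by
        rw [Finset.mul_sum]
    _ ≤ (((N : ℝ) / M) ^ 2) ^ D * aliasWtConst D := mul_le_mul_of_nonneg_left (alias_sum_le N hp) (by positivity)

omit [NeZero N] in
/-- [folklore] The zero alias has fine momentum `p/N`. -/
theorem kfine_zero (p : Fin D → ℝ) (i : Fin D) : kfine N p (0 : TorusSite D N) i = p i / N := by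
  simp [kfine]

/-- [folklore] **THE m = 0 TERM, displayed** (`M, N ≥ 1`): `‖readW 0 κ ρ‖·‖N^D·srcW 0 l ρ′‖/(N²·lapR(p/N)) ≤ 1/(N²·lapR(p/N))` (weights `≤ 1`);
its `1/|p|²` size is the transverse pole of the zero block (A4′(iv)), cancelled by rows L08a / Y09a — NOT here. -/
theorem zero_term_le {M : ℕ} (hM : 0 < M) (p : Fin D → ℝ) (κ l : Fin D) (ρ ρ' : Fin D → ℤ) :
    ‖readW N M (ofRealVec p) 0 κ ρ‖ * ‖(N : ℂ) ^ D * srcW N M (ofRealVec p) 0 l ρ'‖ /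
        ((N : ℝ) ^ 2 * lapR (kfine N p (0 : TorusSite D N)))
      ≤ 1 / ((N : ℝ) ^ 2 * lapR (kfine N p (0 : TorusSite D N))) := by
  refine div_le_div_of_nonneg_right ?_ (mul_nonneg (sq_nonneg _) (lapR_nonneg _))
  exact (norm_readW_mul_norm_srcW_le hM p 0 κ l ρ ρ').trans
    (Finset.prod_le_one (fun i _ => (sinWt_pos _ _).le) fun i _ => sinWt_le_one _ _)

/-- [folklore] JORDAN FORM of the zero denominator: `(4/π²)·|p|² ≤ N²·lapR(p/N)` for `p ∈ [−π, π]^D`, `N ≥ 1`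
(`SymbolTaylor.two_sided_sq_mul_lapSym` BY NAME; `|p|² = King1986.momSq p`). -/
theorem jordan_sq_mul_lapR_zero {p : Fin D → ℝ} (hp : ∀ i, |p i| ≤ π) :
    4 / π ^ 2 * momSq p ≤ (N : ℝ) ^ 2 * lapR (kfine N p (0 : TorusSite D N)) := by
  have hN1 : (1 : ℝ) ≤ N := by exact_mod_cast Nat.pos_of_ne_zero (NeZero.ne N)
  have hN : (0 : ℝ) < N := lt_of_lt_of_le one_pos hN1
  have hq : ∀ κ, |p κ| ≤ π * N := fun κ => (hp κ).trans (by nlinarith [Real.pi_pos])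
  have h := (SymbolTaylor.two_sided_sq_mul_lapSym hN hq).1
  have e : (N : ℝ) ^ 2 * lapR (kfine N p (0 : TorusSite D N)) = ∑ κ, (N : ℝ) ^ 2 * (4 * Real.sin (p κ / (2 * N)) ^ 2) := by
    unfold lapR
    rw [Finset.mul_sum]
    refine Finset.sum_congr rfl fun κ _ => ?_
    rw [kfine_zero, show p κ / N / 2 = p κ / (2 * N) by ring]
  rw [e]
  exact h

/-- [folklore] **THE m = 0 TERM in `|p|` currency**: for `p ∈ [−π, π]^D`, `p ≠ 0` (`momSq p > 0`), `M, N ≥ 1`: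
`‖readW 0 κ ρ‖·‖N^D·srcW 0 l ρ′‖/(N²·lapR(p/N)) ≤ (π²/4)/|p|²`, uniformly in `N` and `M`. -/
theorem zero_term_le_momSq {M : ℕ} (hM : 0 < M) {p : Fin D → ℝ} (hp : ∀ i, |p i| ≤ π) (hp0 : 0 < momSq p)
    (κ l : Fin D) (ρ ρ' : Fin D → ℤ) :
    ‖readW N M (ofRealVec p) 0 κ ρ‖ * ‖(N : ℂ) ^ D * srcW N M (ofRealVec p) 0 l ρ'‖ /
        ((N : ℝ) ^ 2 * lapR (kfine N p (0 : TorusSite D N)))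
      ≤ (π ^ 2 / 4) / momSq p := by
  have hj := jordan_sq_mul_lapR_zero (N := N) hp
  have hlow : 0 < 4 / π ^ 2 * momSq p := by positivity
  refine (zero_term_le hM p κ l ρ ρ').trans ?_
  rw [div_le_div_iff₀ (lt_of_lt_of_le hlow hj) hp0, one_mul]
  have e : π ^ 2 / 4 * (4 / π ^ 2 * momSq p) = momSq p := by field_simp
  nlinarith [e, Real.pi_pos]

/-! ## §4 (iv) The unit exponents of S1c against `CombesThomas.sfStep` / `smStep` -/

section Units

variable {d : ℕ} (Lc j : ℕ)

/-- [folklore] `sfStep Lc j = M` with `M = Lc^j` (the decimation box side of step `j`). -/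
theorem sfStep_eq : sfStep Lc j = ((Lc : ℝ) ^ j) := rfl

/-- [folklore] field–field unit: `sfStep² = M²`. -/
theorem sfStep_sq : sfStep Lc j ^ 2 = ((Lc : ℝ) ^ j) ^ 2 := rfl

/-- [folklore] field–multiplier unit: `sfStep · smStep = M^{d+2}` for every `d` (S1c's `M^{D+1}`, `D = d+1`). -/
theorem sfStep_mul_smStep (d : ℕ) : sfStep Lc j * smStep d Lc j = ((Lc : ℝ) ^ j) ^ (d + 2) := by
  unfold sfStep smStep
  rw [← pow_add, ← pow_mul]
  congr 1
  ring

/-- [folklore] multiplier–multiplier unit: `smStep² = M^{2(d+1)}` for every `d`. -/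
theorem smStep_sq (d : ℕ) : smStep d Lc j ^ 2 = ((Lc : ℝ) ^ j) ^ (2 * (d + 1)) := by
  unfold smStep
  rw [← pow_mul, ← pow_mul]
  congr 1
  ring

/-- [folklore] **S1c AT THE ADOPTED DIMENSION `d = 3` (`D = 4`)**: the three unit factors of `SKELETON-P1.md` S1b′/S1c,
`M^{D−2} = M²`, `M^{D+1} = M⁵`, `M^{D+4} = M⁸`, ARE `sfStep²`, `sfStep·smStep`, `smStep²` — no unit mismatch at the level of exponents
(risk R1 of §6 concerns the endpoint cancellation, not the exponents). -/
theorem units_S1c_at_three :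
    sfStep Lc j ^ 2 = ((Lc : ℝ) ^ j) ^ (4 - 2) ∧
      sfStep Lc j * smStep 3 Lc j = ((Lc : ℝ) ^ j) ^ (4 + 1) ∧ smStep 3 Lc j ^ 2 = ((Lc : ℝ) ^ j) ^ (4 + 4) :=
  ⟨sfStep_sq Lc j, sfStep_mul_smStep Lc j 3, smStep_sq Lc j 3⟩

/-- [folklore] **N-FREENESS OF THE FIELD BLOCK SCALING** (A4′(v) «the field block scales as N^{2−D}·s_f² = Lc^{2−D}» at `D = 4`):
with `N = Lc^(j+1)`, `sfStep² / N² = 1/Lc²`, independent of `j` (`Lc ≠ 0`). -/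
theorem sfStep_sq_div_N_sq {Lc : ℕ} (hLc : Lc ≠ 0) (j : ℕ) :
    sfStep Lc j ^ 2 / (((Lc : ℝ) ^ (j + 1)) ^ 2) = 1 / (Lc : ℝ) ^ 2 := by
  have hL : (Lc : ℝ) ≠ 0 := Nat.cast_ne_zero.2 hLc
  have e : ((Lc : ℝ) ^ (j + 1)) ^ 2 = ((Lc : ℝ) ^ j) ^ 2 * (Lc : ℝ) ^ 2 := by ring
  unfold sfStep
  rw [e]
  field_simp

end Units

end Summit.QuantumFields.BalabanUV.Beta.GAN24.ReadingWeightSums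

end
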